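import Summits.ABC.ABC.Theses.DefiniteXi
import Literature.NumberTheory.Automorphic.BrandtXiSetupIndependence

/-!
# `XiBound` (stmt-ABC-11336, route ABC/DefiniteXi) — negative-side lemmas II: what a refutation needs

Standing-adversary (cdisprove) output for the crux `Summit.ABC.ABC.Theses.DefiniteXi.XiBound`.

* `xiBound_iff_nonneg_const` — WLOG `0 ≤ C`;
* `not_xiBound_iff` — the negation with the inert binder `∀ (N) [NeZero N], conductorNorm = N →`
  eliminated: a violating coprime pair and admissible `N⁻` for every `(A, C)`;
* `xiBound_bound_on_finset`, `xiBound_violators_infinite` — every FINITE family of pairs obeys the bound with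
  any exponent, so a counterexample is an infinite family with `log ξ / log N → ∞`: no Brandt-module census,
  however large, bears on an `∃ C` statement;
* `xiBound_refutation_requires_line` — `¬ XiBound` forces, for all `A` and `C ≥ 0`, a Brandt setup `S` of
  type `(N/N⁻, N⁻)` and a generator `φ ≠ 0` of the `a(E)`-eigen-lattice of its Brandt matrices (so the
  lattice IS a line) with Gross norm `Σ_c w_c φ_c² > C N^A`.  Both locks are arithmetic: rank one is
  Jacquet–Langlands + multiplicity one (absent from the tree), and the size, by Takahashi 2001 Thm 2.3
  (companion file `XiBoundTakahashiSqueeze`), is superpolynomial optimal modular degree, i.e. failure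
  of polynomial Szpiro on Frey curves.

Refuter seat cdisprove-stmt-ABC-11336-g2, 2026-08-15.
-/

namespace Summit.ABC.ABC.Theorems.XiBound.Negative

open scoped BigOperators
open Literature.NumberTheory.Automorphic Literature.NumberTheory.EllipticCurves
open Summit.ABC.ABC.Theses.DefiniteXi

/-- **WLOG `0 ≤ C`** in `XiBound` (replace `C` by `max C 0`; `N^A ≥ 0`). [folklore] -/
theorem xiBound_iff_nonneg_const :
    XiBound ↔ ∃ A C : ℝ, 0 ≤ C ∧ ∀ a b : ℤ, IsCoprime a b → a * b * (a + b) ≠ 0 → ∀ (N : ℕ) [NeZero N],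
      (freyCurve a b).conductorNorm ℤ = N → ∀ Nm : ℕ, Odd Nm → Squarefree Nm →
      Odd Nm.primeFactors.card → Nm ∣ N →
      (brandtXi (N / Nm) Nm (fun n => (freyCurve a b).LFunction n) : ℝ) ≤ C * (N : ℝ) ^ A := by
  constructor
  · rintro ⟨A, C, h⟩
    refine ⟨A, max C 0, le_max_right _ _, fun a b hab h0 N _ hN Nm h1 h2 h3 h4 => ?_⟩
    exact (h a b hab h0 N hN Nm h1 h2 h3 h4).trans
      (mul_le_mul_of_nonneg_right (le_max_left _ _) (Real.rpow_nonneg (Nat.cast_nonneg _) _))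
  · rintro ⟨A, C, -, h⟩
    exact ⟨A, C, h⟩

/-- **The negation of the crux**, with `N` eliminated (`N = conductorNorm`, positive by
`conductorNorm_pos_holds`, so the `[NeZero N]` binder is inert): `XiBound` fails iff for every `(A, C)`
some coprime pair with `ab(a+b) ≠ 0` and some admissible `N⁻ ∣ N` violate the bound. [folklore] -/
theorem not_xiBound_iff :
    ¬ XiBound ↔ ∀ A C : ℝ, ∃ a b : ℤ, IsCoprime a b ∧ a * b * (a + b) ≠ 0 ∧ ∃ Nm : ℕ,
      Odd Nm ∧ Squarefree Nm ∧ Odd Nm.primeFactors.card ∧ Nm ∣ (freyCurve a b).conductorNorm ℤ ∧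
      C * ((freyCurve a b).conductorNorm ℤ : ℝ) ^ A <
        (brandtXi ((freyCurve a b).conductorNorm ℤ / Nm) Nm
          (fun n => (freyCurve a b).LFunction n) : ℝ) := by
  constructor
  · intro h A C
    by_contra hcon
    push Not at hcon
    refine h ⟨A, C, fun a b hab h0 N _ hN Nm h1 h2 h3 h4 => ?_⟩
    subst hN
    exact hcon a b hab h0 Nm h1 h2 h3 h4
  · rintro h ⟨A, C, hAC⟩
    obtain ⟨a, b, hab, h0, Nm, h1, h2, h3, h4, hlt⟩ := h A C
    haveI := isElliptic_freyCurve h0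
    haveI : NeZero ((freyCurve a b).conductorNorm ℤ) :=
      ⟨(WeierstrassCurve.conductorNorm_pos_holds (freyCurve a b)).ne'⟩
    exact (not_le.mpr hlt) (hAC a b hab h0 _ rfl Nm h1 h2 h3 h4)

/-- **Finite families never refute**: for every finite set `F` of pairs and EVERY exponent `A` there is
`C ≥ 0` such that the bound of the crux holds for all `(a, b) ∈ F` with `ab(a+b) ≠ 0` and all `Nm ∣ N`
(admissible or not): `C = Σ_(F) Σ_(Nm ∣ N) ξ · N^(−A)`. [folklore] -/
theorem xiBound_bound_on_finset (F : Finset (ℤ × ℤ)) (A : ℝ) :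
    ∃ C : ℝ, 0 ≤ C ∧ ∀ p ∈ F, p.1 * p.2 * (p.1 + p.2) ≠ 0 →
      ∀ Nm : ℕ, Nm ∣ (freyCurve p.1 p.2).conductorNorm ℤ →
      (brandtXi ((freyCurve p.1 p.2).conductorNorm ℤ / Nm) Nm
          (fun n => (freyCurve p.1 p.2).LFunction n) : ℝ) ≤
        C * ((freyCurve p.1 p.2).conductorNorm ℤ : ℝ) ^ A := by
  classical
  -- per pair: the sum over the divisors of `N` of `ξ · (N^A)⁻¹`
  let ξ : ℤ × ℤ → ℕ → ℝ := fun p Nm =>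
    (brandtXi ((freyCurve p.1 p.2).conductorNorm ℤ / Nm) Nm (fun n => (freyCurve p.1 p.2).LFunction n) : ℝ)
  let g : ℤ × ℤ → ℝ := fun p =>
    ∑ Nm ∈ ((freyCurve p.1 p.2).conductorNorm ℤ).divisors,
      ξ p Nm * (((freyCurve p.1 p.2).conductorNorm ℤ : ℝ) ^ A)⁻¹
  have hg : ∀ p, 0 ≤ g p := fun p =>
    Finset.sum_nonneg fun Nm _ => mul_nonneg (Nat.cast_nonneg _)
      (inv_nonneg.mpr (Real.rpow_nonneg (Nat.cast_nonneg _) _))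
  refine ⟨∑ p ∈ F, g p, Finset.sum_nonneg fun p _ => hg p, fun p hp h0 Nm hNm => ?_⟩
  haveI := isElliptic_freyCurve h0
  have hN : 0 < (freyCurve p.1 p.2).conductorNorm ℤ := WeierstrassCurve.conductorNorm_pos_holds _
  have hNA : 0 < ((freyCurve p.1 p.2).conductorNorm ℤ : ℝ) ^ A :=
    Real.rpow_pos_of_pos (Nat.cast_pos.mpr hN) _
  have hmem : Nm ∈ ((freyCurve p.1 p.2).conductorNorm ℤ).divisors := Nat.mem_divisors.mpr ⟨hNm, hN.ne'⟩
  have h1 : ξ p Nm * (((freyCurve p.1 p.2).conductorNorm ℤ : ℝ) ^ A)⁻¹ ≤ g p :=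
    Finset.single_le_sum (f := fun Nm => ξ p Nm * (((freyCurve p.1 p.2).conductorNorm ℤ : ℝ) ^ A)⁻¹)
      (fun Nm _ => mul_nonneg (Nat.cast_nonneg _) (inv_nonneg.mpr hNA.le)) hmem
  have h2 : g p ≤ ∑ q ∈ F, g q := Finset.single_le_sum (fun q _ => hg q) hp
  calc ξ p Nm = ξ p Nm * (((freyCurve p.1 p.2).conductorNorm ℤ : ℝ) ^ A)⁻¹ *
        ((freyCurve p.1 p.2).conductorNorm ℤ : ℝ) ^ A := by
          rw [mul_assoc, inv_mul_cancel₀ hNA.ne', mul_one]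
    _ ≤ (∑ q ∈ F, g q) * ((freyCurve p.1 p.2).conductorNorm ℤ : ℝ) ^ A :=
          mul_le_mul_of_nonneg_right (h1.trans h2) hNA.le

/-- **A counterexample is an infinite family**: if `XiBound` fails then for EVERY `(A, C)` the set of
violating pairs is infinite (a finite violator set would be absorbed into the constant by
`xiBound_bound_on_finset`).  No computation on finitely many Frey curves can refute the item. [folklore] -/
theorem xiBound_violators_infinite (h : ¬ XiBound) (A C : ℝ) :
    {p : ℤ × ℤ | IsCoprime p.1 p.2 ∧ p.1 * p.2 * (p.1 + p.2) ≠ 0 ∧ ∃ Nm : ℕ,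
      Odd Nm ∧ Squarefree Nm ∧ Odd Nm.primeFactors.card ∧ Nm ∣ (freyCurve p.1 p.2).conductorNorm ℤ ∧
      C * ((freyCurve p.1 p.2).conductorNorm ℤ : ℝ) ^ A <
        (brandtXi ((freyCurve p.1 p.2).conductorNorm ℤ / Nm) Nm
          (fun n => (freyCurve p.1 p.2).LFunction n) : ℝ)}.Infinite := by
  intro hfin
  obtain ⟨C', -, hC'⟩ := xiBound_bound_on_finset hfin.toFinset A
  obtain ⟨a, b, hab, h0, Nm, h1, h2, h3, h4, hlt⟩ := not_xiBound_iff.mp h A (max C C')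
  have hNA : 0 ≤ ((freyCurve a b).conductorNorm ℤ : ℝ) ^ A := Real.rpow_nonneg (Nat.cast_nonneg _) _
  have hviol : (a, b) ∈ {p : ℤ × ℤ | IsCoprime p.1 p.2 ∧ p.1 * p.2 * (p.1 + p.2) ≠ 0 ∧ ∃ Nm : ℕ,
      Odd Nm ∧ Squarefree Nm ∧ Odd Nm.primeFactors.card ∧ Nm ∣ (freyCurve p.1 p.2).conductorNorm ℤ ∧
      C * ((freyCurve p.1 p.2).conductorNorm ℤ : ℝ) ^ A <
        (brandtXi ((freyCurve p.1 p.2).conductorNorm ℤ / Nm) Nm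
          (fun n => (freyCurve p.1 p.2).LFunction n) : ℝ)} :=
    ⟨hab, h0, Nm, h1, h2, h3, h4,
      lt_of_le_of_lt (mul_le_mul_of_nonneg_right (le_max_left _ _) hNA) hlt⟩
  have hle := hC' (a, b) (hfin.mem_toFinset.mpr hviol) h0 Nm h4
  exact (not_le.mpr hlt) (hle.trans (mul_le_mul_of_nonneg_right (le_max_right _ _) hNA))

/-- **Refutation template (the double lock).**  `¬ XiBound` forces, for every exponent `A` and every
`C ≥ 0`: a coprime pair, an admissible `N⁻ ∣ N`, a Brandt setup `S` of type `(N/N⁻, N⁻)` (it exists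
because the value is positive, not the junk `0`), and a generator `φ ≠ 0` of the `a(E)`-eigen-lattice of
the Brandt matrices of `S` — so the lattice IS a line — with `C N^A < Σ_c w_c φ_c²`.  Lock (i), rank one,
is Jacquet–Langlands + strong multiplicity one (not in the tree; cf. `one_le_brandtXi_of_forall`); lock
(ii), the size along an infinite family, is by Takahashi 2001 Thm 2.3 superpolynomial optimal modular
degree, i.e. failure of polynomial Szpiro / abc on Frey curves. [folklore] -/
theorem xiBound_refutation_requires_line (h : ¬ XiBound) (A C : ℝ) (hC : 0 ≤ C) :
    ∃ a b : ℤ, IsCoprime a b ∧ a * b * (a + b) ≠ 0 ∧ ∃ Nm : ℕ,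
      (Odd Nm ∧ Squarefree Nm ∧ Odd Nm.primeFactors.card ∧ Nm ∣ (freyCurve a b).conductorNorm ℤ) ∧
      ∃ S : Brandt.XiSetup ((freyCurve a b).conductorNorm ℤ / Nm) Nm,
        letI : Fintype (Brandt.ClassSet S.O) := Fintype.ofFinite _
        ∃ φ : Brandt.ClassSet S.O → ℤ, φ ≠ 0 ∧
          Brandt.eigenLattice ((freyCurve a b).conductorNorm ℤ / Nm * Nm) (Brandt.matrix S.O)
              (fun n => (freyCurve a b).LFunction n) = ℤ ∙ φ ∧
          C * ((freyCurve a b).conductorNorm ℤ : ℝ) ^ A <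
            ((∑ c, Brandt.weight S.O c * (φ c).natAbs ^ 2 : ℕ) : ℝ) := by
  classical
  obtain ⟨a, b, hab, h0, Nm, h1, h2, h3, h4, hlt⟩ := not_xiBound_iff.mp h A C
  have hpos : 0 < brandtXi ((freyCurve a b).conductorNorm ℤ / Nm) Nm
      (fun n => (freyCurve a b).LFunction n) := by
    have : (0 : ℝ) < (brandtXi ((freyCurve a b).conductorNorm ℤ / Nm) Nm
        (fun n => (freyCurve a b).LFunction n) : ℝ) :=
      lt_of_le_of_lt (mul_nonneg hC (Real.rpow_nonneg (Nat.cast_nonneg _) _)) hlt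
    exact_mod_cast this
  -- a positive value is not the junk of a missing setup
  have hne : Nonempty (Brandt.XiSetup ((freyCurve a b).conductorNorm ℤ / Nm) Nm) := by
    by_contra hno
    rw [brandtXi_of_isEmpty (not_nonempty_iff.mp hno)] at hpos
    exact lt_irrefl 0 hpos
  obtain ⟨S⟩ := hne
  refine ⟨a, b, hab, h0, Nm, ⟨h1, h2, h3, h4⟩, S, ?_⟩
  letI : Fintype (Brandt.ClassSet S.O) := Fintype.ofFinite _
  have hxi : brandtXi ((freyCurve a b).conductorNorm ℤ / Nm) Nm (fun n => (freyCurve a b).LFunction n) =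
      Brandt.xi (Brandt.weight S.O) (Brandt.eigenLattice ((freyCurve a b).conductorNorm ℤ / Nm * Nm)
        (Brandt.matrix S.O) (fun n => (freyCurve a b).LFunction n)) := by
    rw [S.brandtXi_eq_xi, Brandt.XiSetup.xi, Brandt.xiOfOrder_eq]
  -- a positive `ξ` is not the junk of a lattice of rank ≠ 1
  have hline : ∃ φ : Brandt.ClassSet S.O → ℤ, φ ≠ 0 ∧
      Brandt.eigenLattice ((freyCurve a b).conductorNorm ℤ / Nm * Nm) (Brandt.matrix S.O)
        (fun n => (freyCurve a b).LFunction n) = ℤ ∙ φ := by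
    by_contra hno
    rw [hxi, Brandt.xi_of_not_isLine _ hno] at hpos
    exact lt_irrefl 0 hpos
  obtain ⟨φ, hφ, hL⟩ := hline
  refine ⟨φ, hφ, hL, ?_⟩
  rwa [hxi, Brandt.xi_eq_sum _ hφ hL] at hlt

end Summit.ABC.ABC.Theorems.XiBound.Negative
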